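import Mathlib
import Summits.NavierStokesRegularity.NavierStokesRegularity.Theorems.EulerZoomLiouvillePowerGaugeEulerLiouvilleSelfSimilarSteadyProfile
import HarnessLib

/-!
# The SHIFTED homogeneous stratum of crux E is empty: a member exactly self-similar about `(T, x₀)` with a
# critically homogeneous velocity profile is STEADY, hence trivial
# (crux `EulerZoomLiouville.PowerGaugeEulerLiouville` = stmt-NavierStokesRegularity-19832, line `birth`, rung C1)

Route `EulerZoomLiouville` (NavierStokesRegularity).  Twin of `SteadyProfile.selfSimilar_ae_eq_zero_of_homogeneousProfile`
(p579922, ns-typeII-critic-1 g12's model-class finding in kernel form) for members exactly self-similar about ANY space–time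
point `(T, x₀)`, `T ≥ 0`: if `V (s • y) = s^{−(1+ρ)} • V y` (`s > 0`), then
`(T−τ)^{γ−1} V((T−τ)^{−γ}(x − x₀)) = V(x − x₀)` for every `τ < 0` (`γ = 1/(2+ρ)`, `(γ−1) + γ(1+ρ) = 0`), so the member is
STEADY on the slab and rung B (`SteadyProfile.selfSimilar_ae_eq_zero_of_steadyProfile` ← `powerGaugeEulerLiouville_steady`:
`E`-gauge ⇒ zero weak gradient ⇒ constant ⇒ `A`-gauge) kills it.

* `Shifted.selfSimilarCollapse_shifted_eq_of_homogeneous` — the pointwise identity;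
* `Shifted.selfSimilar_ae_eq_zero_of_homogeneousProfile` — member level, crux hypotheses verbatim, any `ρ > 0`.

Used by skeleton v18 of the crux (the shifted stub becomes `IsBoundedSmoothProfile V ∨ IsHomogeneousProfile ρ V`, symmetric
to `stub_selfSimilarClassical`).  WHAT THIS IS NOT: not NS, not E — an (empty) explicit family moved out of
`stub_nonSelfSimilarRest`; `--supports` stmt-19832. [folklore]
-/

noncomputable section

-- flat `Theorems/<Route><Decl>…` files of one crux share the namespace of the crux (tree convention: `Summit.<S>.<S>.…`)
set_option linter.dupNamespace false

open MeasureTheory Set Filter Topology Metric Function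
open scoped NNReal ENNReal

namespace Summit.NavierStokesRegularity.NavierStokesRegularity.Theorems.PowerGaugeEulerLiouville.Shifted

open Literature.Analysis Literature.Analysis.FluidPDE

/-- **A critically homogeneous profile makes the SHIFTED collapse ansatz steady**: if `V (s • y) = s^{−(1+ρ)} • V y` for
all `s > 0` (`ρ > 0`), then `selfSimilarCollapse (1/(2+ρ)) T V τ y = V y` for every `τ < T` (exponents
`(T−τ)^{γ−1} · ((T−τ)^{−γ})^{−(1+ρ)} = 1`, `γ(2+ρ) = 1`); `T`-shifted twin of
`SteadyProfile.selfSimilarCollapse_eq_of_homogeneous`. [folklore] -/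
theorem selfSimilarCollapse_shifted_eq_of_homogeneous {ρ : ℝ} (hρ : 0 < ρ)
    {V : EuclideanSpace ℝ (Fin 3) → EuclideanSpace ℝ (Fin 3)}
    (hV : ∀ s : ℝ, 0 < s → ∀ y, V (s • y) = s ^ (-(1 + ρ)) • V y) {T τ : ℝ} (hτ : τ < T)
    (y : EuclideanSpace ℝ (Fin 3)) :
    selfSimilarCollapse (1 / (2 + ρ)) T V τ y = V y := by
  have hpos : 0 < T - τ := by linarith
  have h2 : (2 + ρ) ≠ 0 := by positivity
  rw [selfSimilarCollapse_apply, hV _ (Real.rpow_pos_of_pos hpos _), smul_smul]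
  have : (T - τ) ^ (1 / (2 + ρ) - 1) * ((T - τ) ^ (-(1 / (2 + ρ)))) ^ (-(1 + ρ)) = 1 := by
    rw [← Real.rpow_mul hpos.le, ← Real.rpow_add hpos]
    have : 1 / (2 + ρ) - 1 + -(1 / (2 + ρ)) * -(1 + ρ) = 0 := by field_simp; ring
    rw [this, Real.rpow_zero]
  rw [this, one_smul]

/-- **THE SHIFTED HOMOGENEOUS STRATUM IS EMPTY** (crux hypotheses verbatim, any `ρ > 0`): a member exactly self-similar
about the space–time point `(T, x₀)`, `T ≥ 0` — `u(τ, x) = (T−τ)^{γ−1} V((T−τ)^{−γ}(x − x₀))` for `τ < 0`,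
`γ = 1/(2+ρ)` — whose velocity profile is critically homogeneous, `V (s • y) = s^{−(1+ρ)} • V y` (`s > 0`), is steady on the
slab (`u(τ, x) = V(x − x₀)`), hence `u = 0` a.e. by rung B (`SteadyProfile.selfSimilar_ae_eq_zero_of_steadyProfile`).
Nothing is assumed on the pressure. [folklore] -/
theorem selfSimilar_ae_eq_zero_of_homogeneousProfile {ρ : ℝ} (hρ : 0 < ρ) {T : ℝ} (hT : 0 ≤ T)
    (x₀ : EuclideanSpace ℝ (Fin 3))
    {u : ℝ → EuclideanSpace ℝ (Fin 3) → EuclideanSpace ℝ (Fin 3)} {p : ℝ → EuclideanSpace ℝ (Fin 3) → ℝ}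
    {H : ℝ → EuclideanSpace ℝ (Fin 3) → EuclideanSpace ℝ (Fin 3) →L[ℝ] EuclideanSpace ℝ (Fin 3)} {c : ℝ≥0}
    (hsw : IsSuitableWeakSolutionOn (slab (EuclideanSpace ℝ (Fin 3)) (Iio 0) isOpen_Iio) 0 0 u p)
    (hH : HasWeakSpatialGradientOn (slab (EuclideanSpace ℝ (Fin 3)) (Iio 0) isOpen_Iio) u H)
    (hgauge : ∀ a : ℝ, 0 < a →
      ENNReal.ofReal (a ^ (2 * ρ)) * cknA a (0 : ℝ × EuclideanSpace ℝ (Fin 3)) u +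
          ENNReal.ofReal (a ^ ρ) * cknE a (0 : ℝ × EuclideanSpace ℝ (Fin 3)) H +
        ENNReal.ofReal (a ^ (2 * ρ)) * cknD a (0 : ℝ × EuclideanSpace ℝ (Fin 3)) p ≤ (c : ℝ≥0∞))
    {V : EuclideanSpace ℝ (Fin 3) → EuclideanSpace ℝ (Fin 3)}
    (hu : ∀ τ : ℝ, τ < 0 → u τ = fun x => selfSimilarCollapse (1 / (2 + ρ)) T V τ (x - x₀))
    (hV : ∀ s : ℝ, 0 < s → ∀ y, V (s • y) = s ^ (-(1 + ρ)) • V y) :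
    uncurry u =ᵐ[volume.restrict (Iio (0 : ℝ) ×ˢ (univ : Set (EuclideanSpace ℝ (Fin 3))))] 0 :=
  SteadyProfile.selfSimilar_ae_eq_zero_of_steadyProfile hρ hsw hH hgauge (V := fun x => V (x - x₀)) fun τ hτ => by
    rw [hu τ hτ]
    funext x
    exact selfSimilarCollapse_shifted_eq_of_homogeneous hρ hV (by linarith) (x - x₀)

end Summit.NavierStokesRegularity.NavierStokesRegularity.Theorems.PowerGaugeEulerLiouville.Shifted

end
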